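import Mathlib
import HarnessLib
import Literature.Analysis.FluidPDE.TypeIAncientMildRescale
import Summits.NavierStokesRegularity.NavierStokesRegularity.Theorems.PoloidalWindowDoorLrcModEntireThreadPressure

/-!
# Item `LrcModEntire` (stmt-NavierStokesRegularity-20428), skeleton twist_split v6 — cell T1 of the (TH) column («flat thread plane»), STEP (II) of the LEAD's
# T1 kill plan (Cruxes/LrcModEntire/CELLS-TH-g13.md §2bis): **a flat hot SLICE forces a linear pressure** — `∂_z P(−1,x) = −v₂(−1,0)/2` at EVERY `x ∈ ℝ³`

Cell ns-regularity-ideate, LEAD ns-poloidal-K2-p3 g13 (`--supports stmt-NavierStokesRegularity-20428`).  If the vertical component of the slice is constant,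
`v₂(−1,·) ≡ N := v₂(−1,0)` on all of `ℝ³`, while the hot-spot bound `√(−t)|v₂(t,x)| ≤ |N|` holds, then EVERY point `x` is a space–time hot spot: translating
the class (`IsTypeIAncientMild.comp_add_right`) and the tree's time pin `…ThreadPins.threadTimePin` give `∂ₜv₂(−1,x) = N/2`, and the vertical momentum equation
of any classical pressure `P` of the profile (`IsClassicalNSSolutionOn (Iio 0) 1 0 v P`, which exists by `exists_isClassicalNSSolutionOn_Iio_of_isTypeIAncientMild`)
reads `N/2 + 0 = 0 − ∂_z P(−1,x)` (`(v·∇)v₂ = 0` and `Δv₂ = 0` for the constant `v₂(−1,·)`):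

* `class_comp_add_right` — the route's four-hypothesis class is translation invariant (repackaged from `IsTypeIAncientMild.comp_add_right`);
* `timePin_of_flatSlice` — `∂ₜv₂(−1,x) = N/2` at every `x`;
* `gradient_pressure_two_of_flatSlice` — **`(∇P(−1,·))(x)₂ = −N/2` at every `x`**: the pressure slice is `P(−1,xₕ,z) = P(−1,xₕ,0) − Nz/2`, LINEAR in `z` —
  incompatible with the `L∞(BMO)` pressure of a bounded mild solution (Koch–Nadirashvili–Seregin–Šverák 2009 §4; the one Literature fact (F2) that closes T1's
  step (II); step (I), «flat thread PLANE ⇒ flat SLICE», is the formal z-series argument of CELLS-TH-g13 §2bis).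

WHAT THIS IS NOT: not a claim about Navier–Stokes regularity; T1 and the stub stay OPEN (bears_on LADDER-NS N0, item 20428 / crux 19708).
-/

noncomputable section

-- the summit and its single sub-problem share the name (CONVENTIONS §1), as in every Theorems file
set_option linter.dupNamespace false

namespace Summit.NavierStokesRegularity.NavierStokesRegularity.Theorems.PoloidalWindowDoorLrcModEntireTwistingTHFlatSlicePressure

open MeasureTheory Set Function Filter Topology
open scoped RealInnerProductSpace InnerProductSpace Laplacian ContDiff
open Literature.Analysis Literature.Analysis.FluidPDE Literature.Analysis.UnboundedOperators
open Summit.NavierStokesRegularity.NavierStokesRegularity.Theorems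
open Summit.NavierStokesRegularity.NavierStokesRegularity.Theorems.PoloidalWindowDoorLrcModEntireThreadPins
open Summit.NavierStokesRegularity.NavierStokesRegularity.Theorems.PoloidalWindowDoorPoloidalWindowRigidityLocalFrozenLaw
open Summit.NavierStokesRegularity.NavierStokesRegularity.Theorems.PoloidalWindowDoorPoloidalWindowRigidityWindow
open Summit.NavierStokesRegularity.NavierStokesRegularity.Theorems.PoloidalWindowDoorLrcModEntireThreadPressure

variable {C : ℝ} {v : ℝ → EuclideanSpace ℝ (Fin 3) → EuclideanSpace ℝ (Fin 3)}

/-- **The route's class is translation invariant**: the four class hypotheses (Type-I time decay, continuity, Oseen-mild ancient, divergence-free) pass to the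
translated profile `(t, y) ↦ v(t, y + a)` (`IsTypeIAncientMild.comp_add_right` unpacked; `heatFlow = heatExtension` for positive times). -/
theorem class_comp_add_right (hrate : HasTypeITimeDecay C v)
    (hcont : ContinuousOn (uncurry v) (Iio (0 : ℝ) ×ˢ univ))
    (hmild : ∀ s t : ℝ, s < t → t < 0 → ∀ x, v t x = heatExtension (v s) (t - s) x - oseenDuhamel 1 s v v t x)
    (hdiv : ∀ t < 0, VectorCalculus.IsDivFree (v t)) (a : EuclideanSpace ℝ (Fin 3)) :
    HasTypeITimeDecay C (fun t y => v t (y + a)) ∧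
      ContinuousOn (uncurry fun t y => v t (y + a)) (Iio (0 : ℝ) ×ˢ univ) ∧
      (∀ s t : ℝ, s < t → t < 0 → ∀ x, (fun t y => v t (y + a)) t x =
        heatExtension ((fun t y => v t (y + a)) s) (t - s) x -
          oseenDuhamel 1 s (fun t y => v t (y + a)) (fun t y => v t (y + a)) t x) ∧
      (∀ t < 0, VectorCalculus.IsDivFree ((fun t y => v t (y + a)) t)) := by
  have h := (isTypeIAncientMild_of_class hrate hcont hmild hdiv).comp_add_right a
  refine ⟨fun t ht y => h.norm_le ht y, h.contDiffOn.continuousOn, fun s t hst ht x => ?_, fun t ht => h.isDivFree ht⟩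
  have hm := h.mild_eq hst ht x
  rw [heatFlow_of_pos _ (sub_pos.2 hst)] at hm
  exact hm

/-- **Time pin at every point of a flat hot slice**: if `v₂(−1,·) ≡ v₂(−1,0) ≠ 0` and `√(−t)|v₂(t,x)| ≤ |v₂(−1,0)|`, then `∂ₜv₂(−1,x) = v₂(−1,0)/2` for every
`x` (the tree's `threadTimePin` for the translated profile). -/
theorem timePin_of_flatSlice (hrate : HasTypeITimeDecay C v)
    (hcont : ContinuousOn (uncurry v) (Iio (0 : ℝ) ×ˢ univ))
    (hmild : ∀ s t : ℝ, s < t → t < 0 → ∀ x, v t x = heatExtension (v s) (t - s) x - oseenDuhamel 1 s v v t x)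
    (hdiv : ∀ t < 0, VectorCalculus.IsDivFree (v t))
    (hne : v (-1) 0 2 ≠ 0) (hhot : ∀ t < 0, ∀ x, Real.sqrt (-t) * |v t x 2| ≤ |v (-1) 0 2|)
    (hflat : ∀ x, v (-1) x 2 = v (-1) 0 2) (x : EuclideanSpace ℝ (Fin 3)) :
    deriv (fun s => v s x 2) (-1) = v (-1) 0 2 / 2 := by
  obtain ⟨hrate', hcont', hmild', -⟩ := class_comp_add_right hrate hcont hmild hdiv x
  have hx : v (-1) (0 + x) 2 = v (-1) 0 2 := by rw [zero_add]; exact hflat x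
  have hne' : (fun t y => v t (y + x)) (-1) 0 2 ≠ 0 := by
    show v (-1) (0 + x) 2 ≠ 0
    rw [hx]; exact hne
  have hhot' : ∀ t < 0, ∀ y, Real.sqrt (-t) * |(fun t y => v t (y + x)) t y 2| ≤ |(fun t y => v t (y + x)) (-1) 0 2| := by
    intro t ht y
    show Real.sqrt (-t) * |v t (y + x) 2| ≤ |v (-1) (0 + x) 2|
    rw [hx]; exact hhot t ht (y + x)
  have h := threadTimePin hrate' hcont' hmild' hne' hhot'
  simp only [zero_add] at h
  rw [h, hflat x]

/-- **A FLAT HOT SLICE FORCES A LINEAR PRESSURE.**  Route class, hot-spot normalisation `v₂(−1,0) ≠ 0`, `√(−t)|v₂(t,x)| ≤ |v₂(−1,0)|`, a flat vertical slice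
`v₂(−1,·) ≡ v₂(−1,0)`, and any classical pressure `P` of the profile on `t < 0` ⇒ `(∇P(−1,·))(x)₂ = −v₂(−1,0)/2` at EVERY `x ∈ ℝ³` (vertical momentum equation:
`∂ₜv₂ + (v·∇)v₂ = Δv₂ − ∂_z P` with `∂ₜv₂ = N/2` (`timePin_of_flatSlice`), `(v·∇)v₂ = 0`, `Δv₂ = 0`). -/
theorem gradient_pressure_two_of_flatSlice (hrate : HasTypeITimeDecay C v)
    (hcont : ContinuousOn (uncurry v) (Iio (0 : ℝ) ×ˢ univ))
    (hmild : ∀ s t : ℝ, s < t → t < 0 → ∀ x, v t x = heatExtension (v s) (t - s) x - oseenDuhamel 1 s v v t x)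
    (hdiv : ∀ t < 0, VectorCalculus.IsDivFree (v t))
    (hne : v (-1) 0 2 ≠ 0) (hhot : ∀ t < 0, ∀ x, Real.sqrt (-t) * |v t x 2| ≤ |v (-1) 0 2|)
    (hflat : ∀ x, v (-1) x 2 = v (-1) 0 2)
    {P : ℝ → EuclideanSpace ℝ (Fin 3) → ℝ} (hP : IsClassicalNSSolutionOn (Iio 0) 1 0 v P) (x : EuclideanSpace ℝ (Fin 3)) :
    gradient (P (-1)) x 2 = -(v (-1) 0 2) / 2 := by
  have hs : (-1 : ℝ) < 0 := by norm_num
  have hsm : IsSmoothSpaceTimeOn (Iio 0) v := hP.smooth_velocity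
  -- the momentum equation at `(−1, x)`
  have hmom := hP.momentum (-1) hs x
  have htd : timeDerivWithin (Iio 0) v (-1) x = deriv (fun s => v s x) (-1) := by
    rw [timeDerivWithin_apply, derivWithin_of_mem_nhds (Iio_mem_nhds hs)]
  rw [htd, convect_apply, one_smul, Pi.zero_apply, Pi.zero_apply, add_zero] at hmom
  -- time-differentiability of `s ↦ v s x` at `−1`
  have hct : ContDiffAt ℝ ∞ (uncurry v) ((-1 : ℝ), x) := hsm.contDiffAt isOpen_Iio (mem_Iio.2 hs) x
  have hd : DifferentiableAt ℝ (uncurry v) ((-1 : ℝ), x) := hct.differentiableAt (by simp)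
  have hl : DifferentiableAt ℝ (fun s : ℝ => ((s, x) : ℝ × EuclideanSpace ℝ (Fin 3))) (-1) :=
    differentiableAt_id.prodMk (differentiableAt_const _)
  have hline : DifferentiableAt ℝ (fun s => v s x) (-1) := by
    have h := hd.comp (-1) hl
    exact h
  -- the slice is smooth; its vertical component is the constant `N`
  have hslice : ContDiff ℝ ∞ (v (-1)) := IsSmoothSpaceTimeOn.contDiff_slice (S := Iio 0) (w := v) hsm hs
  have hslice2 : ContDiffAt ℝ 2 (v (-1)) x := (hslice.of_le (by norm_cast)).contDiffAt
  have hVd : Differentiable ℝ (v (-1)) := hslice.differentiable (by simp)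
  have hconst : (fun y : EuclideanSpace ℝ (Fin 3) => v (-1) y 2) = fun _ => v (-1) 0 2 := funext hflat
  have hconv : fderiv ℝ (v (-1)) x (v (-1) x) 2 = 0 := by
    have h := (EuclideanSpace.proj (𝕜 := ℝ) (2 : Fin 3)).hasFDerivAt.comp x (hVd x).hasFDerivAt
    have e : fderiv ℝ (fun y => v (-1) y 2) x (v (-1) x) = fderiv ℝ (v (-1)) x (v (-1) x) 2 := by
      rw [show (fun y => v (-1) y 2) = (EuclideanSpace.proj (𝕜 := ℝ) (2 : Fin 3)) ∘ v (-1) from rfl, h.fderiv]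
      simp
    rw [← e, hconst]
    simp
  have hlap : (Δ (fun y : EuclideanSpace ℝ (Fin 3) => v (-1) y 2)) x = 0 := by
    rw [hconst]; simp
  -- components
  have hcomp := congrArg (fun w : EuclideanSpace ℝ (Fin 3) => w 2) hmom
  simp only [PiLp.add_apply, PiLp.sub_apply] at hcomp
  rw [deriv_apply_coord hline 2, timePin_of_flatSlice hrate hcont hmild hdiv hne hhot hflat x, hconv,
    laplacian_apply_coord hslice2 2, hlap] at hcomp
  linarith

/-- **Corollary (the class supplies the pressure):** under the same hypotheses there IS a classical pressure `P` on `t < 0`, and every such `P` has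
`(∇P(−1,·))(x)₂ = −v₂(−1,0)/2` for all `x` — the pressure slice is linear in `z` with slope `−v₂(−1,0)/2 ≠ 0`. -/
theorem exists_linearPressure_of_flatSlice (hrate : HasTypeITimeDecay C v)
    (hcont : ContinuousOn (uncurry v) (Iio (0 : ℝ) ×ˢ univ))
    (hmild : ∀ s t : ℝ, s < t → t < 0 → ∀ x, v t x = heatExtension (v s) (t - s) x - oseenDuhamel 1 s v v t x)
    (hdiv : ∀ t < 0, VectorCalculus.IsDivFree (v t))
    (hne : v (-1) 0 2 ≠ 0) (hhot : ∀ t < 0, ∀ x, Real.sqrt (-t) * |v t x 2| ≤ |v (-1) 0 2|)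
    (hflat : ∀ x, v (-1) x 2 = v (-1) 0 2) :
    ∃ P : ℝ → EuclideanSpace ℝ (Fin 3) → ℝ, IsClassicalNSSolutionOn (Iio 0) 1 0 v P ∧
      ∀ x, gradient (P (-1)) x 2 = -(v (-1) 0 2) / 2 := by
  obtain ⟨P, hP⟩ := exists_isClassicalNSSolutionOn_Iio_of_isTypeIAncientMild (isTypeIAncientMild_of_class hrate hcont hmild hdiv)
  exact ⟨P, hP, gradient_pressure_two_of_flatSlice hrate hcont hmild hdiv hne hhot hflat hP⟩

end Summit.NavierStokesRegularity.NavierStokesRegularity.Theorems.PoloidalWindowDoorLrcModEntireTwistingTHFlatSlicePressure
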